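import Mathlib
import Literature.MathematicalPhysics.QuantumFieldTheory.Balaban1983to89.Beta.GaussianIntegral

/-!
# `Balaban1983to89.B14.Eq328GaussianIBP` — [Balaban1988Convergent] (3.28)–(3.29) p. 272: the expansion in the external
fluctuation field `A_k` — GAUSSIAN INTEGRATION BY PARTS with a general covariance, its tilted form, and the absorption of the
linear term (the mechanism of the second equality of (3.28)), PROVED in finite dimensions

statement-level skeleton of published theorems with citation tags; proofs where landed; nothing here is a
claim about the Yang–Mills mass gap

PDF held: `paper:balaban1988-cmp119-convergent-renormalization` (journal page = PDF page + 242; (3.28)–(3.29) read on the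
x2 renders p029/p030 of `run/shared/lean/pub/pub-balaban/b2b-balaban-ref1/pages/1988-cmp119-convergent-renormalization/`).

CITATION HEADER (lean-in-tree rule).  Source: T. Bałaban, *Convergent renormalization expansions for lattice gauge
theories*, Commun. Math. Phys. **119**, 243–285 (1988), doi:10.1007/bf01217741 [Balaban1988Convergent] (cell paper B14 =
"[III]").  Mega-formalization `lit-balaban` (HOME `run/shared/lean/pub/lit-balaban/`), reader/typer unit `lit-balaban-r11`
(generation 2), SKELETON row **B14.Eq3.28–3.29** (row of record: `B14Interpolation` types the SHAPE of the `t`-interpolation;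
the display itself was absent).  The classical identities used are Glimm–Jaffe, *Quantum Physics* (2nd ed., 1987) §9.1:
(9.1.27) translation of a Gaussian measure `dφ_C = exp[−½⟨g, C⁻¹g⟩ − ⟨C⁻¹g, ψ⟩] dψ_C`, (9.1.28) the Gaussian integration by
parts formula `∫ φ(f) A dφ_C = ∫ ⟨Cf, δA/δφ⟩ dφ_C`, and (9.1.32) its form for a tilted measure `dμ = e^{−V}dφ_C / ∫e^{−V}dφ_C`:
`∫ φ(f) A dμ = ∫ ⟨C f, δA/δφ − A δV/δφ⟩ dμ` [GlimmJaffe1987].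

THE PRINTED TEXT (verbatim, pp. 271–272 [PDF 29–30]).  *"At first we separate obvious boundary terms connected with the
external fluctuation field A_k, by expanding in this field. We introduce the parameter t multiplying A_k in the expressions in
the logarithm. We have
  log[z^{(k)} ∫ dA χ^{(k)} exp[−½⟨A, C*Δ^{(k)}CA⟩ − ….(s = 0, t = 0)….]]
  = ∫₀¹ dt ⟨ −⟨A, C*Δ^{(k)}CA_k⟩ + ⟨(δ/δtA_k) 𝐏^{(k)}(g_k, (tA_k, A)), A_k⟩ + ⟨(δ/δtA_k) 𝐄_k(U_k(….)), A_k⟩ ⟩_t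
    − ½⟨A_k, C*Δ^{(k)}CC^{(k)}(Λ_{k+1})C*Δ^{(k)}CA_k⟩ + log[z^{(k)} ∫ dA χ^{(k)} exp[−½⟨A, C*Δ^{(k)}CA⟩ − ….(s = 0, t = 0, A_k = 0)….]]
  = ∫₀¹ dt ⟨ −⟨A_k, C*Δ^{(k)}CC^{(k)}(Λ_{k+1})((δ/δA)χ^{(k)} + (δ/δA)𝐏^{(k)}(g_k, (tA_k, A)) + (δ/δA)𝐄_k(U_k(….)))⟩
    + ⟨(δ/δtA_k) 𝐏^{(k)}(g_k, (tA_k, A)), A_k⟩ + ⟨(δ/δtA_k) 𝐄_k(U_k(…)), A_k⟩ ⟩_t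
    + log[z^{(k)} ∫ dA χ^{(k)} exp[−½⟨A, C*Δ^{(k)}CA⟩ + 𝐏^{(k)}(g_k, A) + {𝐄_k(U_k(exp i[g_kCA − hD̃(g_kCA)]V^{(k)})) − 𝐄_k(U_{k+1})}]].  (3.28)
  Here ⟨·⟩_t denotes the expectation value with respect to the probabilistic measure
  Z_t^{−1} dμ_{C^{(k)}(Λ_{k+1})}(A) χ^{(k)} exp[−t⟨A, C*Δ^{(k)}CA_k⟩ + 𝐏^{(k)}(g_k, (tA_k, A)) + {𝐄_k(U_k(…(tA_k, A)…)) − 𝐄_k(U_{k+1})}].  (3.29)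
  The first expression on the right-hand side of (3.28) is the expectation value of the sum of terms with at least one
  localization in the domain Ω_{k+1}∖Λ_{k+1}, hence this expression contributes to 𝐁^{(k+1)} only."*

READING (how the two equalities of (3.28) arise; recorded for the fold).  Write `w₀ := C*Δ^{(k)}CA_k` (a fixed vector in the
space of the fluctuation variables `A`), `dμ_C`, `C := C^{(k)}(Λ_{k+1})`, for the Gaussian measure, and
`K_t(A) := χ^{(k)} exp[−t⟨A, w₀⟩ + 𝐏^{(k)}(g_k,(tA_k,A)) + {…}] = e^{−t⟨A,w₀⟩} H_t(A)` for the weight of (3.29), `Z_t = ∫ K_t dμ_C`.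
(a) FIRST EQUALITY = the fundamental theorem of calculus in `t ∈ [0,1]` for `log ∫ K_t dμ_C` (`d/dt log Z_t = ⟨∂_t log K_t⟩_t`),
    the term quadratic in `tA_k` of (3.25) contributing the constant `−½⟨A_k, C*Δ^{(k)}CC C*Δ^{(k)}CA_k⟩`.  This is the measure-
    theoretic interchange PROVED by seat p27 (generation 2) as `B14.InterpolationMeasure.hasDerivAt_log_partFn` /
    `eq330_gibbs` (module `B14InterpolationMeasure`, p243938) — cited, not restated here.
(b) SECOND EQUALITY = Gaussian integration by parts (9.1.28)/(9.1.32) applied to the linear integrand `−⟨A, w₀⟩` against the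
    tilted weight: `⟨⟨A, w₀⟩ K_t⟩_{μ_C} = ⟨∂_{Cw₀} K_t⟩_{μ_C} = −t⟨w₀, Cw₀⟩ Z_t + ⟨e^{−t⟨A,w₀⟩} ∂_{Cw₀}H_t⟩_{μ_C}`, i.e.
    `⟨−⟨A, w₀⟩⟩_t = t⟨A_k, C*Δ^{(k)}C C C*Δ^{(k)}CA_k⟩ − ⟨⟨A_k, C*Δ^{(k)}C C (δ/δA) log H_t⟩⟩_t` (C symmetric), and
    `∫₀¹ t dt = ½` CANCELS the constant of (a) — which is why `−½⟨A_k, …A_k⟩` is absent from the last member of (3.28) and the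
    `δ/δA`-terms of `χ^{(k)}`, `𝐏^{(k)}`, `𝐄_k` (= `(δ/δA) log H_t`, the derivative of the characteristic function being formal in
    print) appear instead.

WHAT IS TYPED AND PROVED (finite index type `ι`, Lebesgue measure on `ι → ℝ`, the `Beta.GaussianIntegral` convention
`ρ_Q(v) = exp(−½ vᵀQv)`, `Q` positive definite = the precision matrix, `C = Q⁻¹` the covariance; all theorems, no definitions,
no named facts, 0 sorry):
§1 CALCULUS OF THE GAUSSIAN DENSITY: `hasFDerivAt_quadForm` (`D(vᵀQv)(x)u = xᵀQu + (Qx)ᵀu`), `hasFDerivAt_dotProduct_const`,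
   `hasFDerivAt_gaussDensity` / `fderiv_gaussDensity_apply` (`Dρ_Q(x)u = −(xᵀQu)ρ_Q(x)`, `Q` symmetric), `differentiable_gaussDensity`.
§2 MOMENT INTEGRABILITY: `integrable_coord_mul_gaussStd`, `integrable_dotProduct_mul_gaussStd`, and for positive definite `Q`
   `integrable_dotProduct_mul_gaussDensity` (`v ↦ ⟨v,w⟩ρ_Q(v)` is integrable; `Q = BᵀB` and the tree's linear change of variables
   `Beta.GaussianIntegral.integrable_comp_mulVec`).
§3 GAUSSIAN INTEGRATION BY PARTS (Glimm–Jaffe (9.1.28), finite-dimensional; Stein's / Wick's identity with a general covariance):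
   `integral_dotProduct_mul_mul_gaussDensity_of_integrable` — for `G` differentiable with the three products integrable,
   `∫ ⟨v,w⟩ G(v) ρ_Q(v) dv = ∫ (∂_{Q⁻¹w}G)(v) ρ_Q(v) dv`; `integral_dotProduct_mul_mul_gaussDensity` — the same for `G ∈ C¹` bounded
   with bounded derivative (integrabilities discharged); covariance forms `…_cov_of_integrable`, `…_cov`:
   `∫ ⟨v,w⟩ G ρ_{C⁻¹} = ∫ (∂_{Cw}G) ρ_{C⁻¹}` — verbatim the shape `⟨Cf, δ/δφ⟩` of (9.1.28).  Tool: Mathlib's whole-space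
   integration by parts `integral_mul_fderiv_eq_neg_fderiv_mul_of_integrable` and `∂_{Q⁻¹w}ρ_Q = −⟨·,w⟩ρ_Q`.
§4 THE (3.28)–(3.29) STEP: `gaussDensity_linear_tilt` — completing the square (Glimm–Jaffe (9.1.27) pointwise):
   `e^{−t⟨v,w₀⟩}ρ_{C⁻¹}(v) = e^{(t²/2)⟨w₀,Cw₀⟩} ρ_{C⁻¹}(v + tCw₀)`; the integrabilities of the TILTED weight
   (`integrable_linear_tilt_gaussDensity`, `integrable_dotProduct_mul_linear_tilt_gaussDensity`); `hasFDerivAt_tilt`;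
   **`eq328_tilted_ibp`** — for `H ∈ C¹` bounded with bounded derivative, every `w₀, w, t`:
   `∫ ⟨v,w⟩ e^{−t⟨v,w₀⟩}H(v) ρ_{C⁻¹}(v) dv = −t⟨Cw, w₀⟩ ∫ e^{−t⟨v,w₀⟩}H ρ_{C⁻¹} + ∫ e^{−t⟨v,w₀⟩}(∂_{Cw}H) ρ_{C⁻¹}`
   ((9.1.32) with the linear-plus-`log H` tilt of (3.29)); **`eq328_linear_term`** — the printed case `w = w₀`:
   `∫ (−⟨v,w₀⟩) K_t ρ_{C⁻¹} = t⟨w₀, Cw₀⟩ ∫ K_t ρ_{C⁻¹} − ∫ e^{−t⟨v,w₀⟩}(∂_{Cw₀}H) ρ_{C⁻¹}`, `K_t = e^{−t⟨·,w₀⟩}H`; and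
   `eq328_half` — `∫₀¹ t·c dt = ½c`, the cancellation against `−½⟨A_k, C*Δ^{(k)}CC^{(k)}(Λ_{k+1})C*Δ^{(k)}CA_k⟩`.

SCOPE / WHAT IS NOT HERE.  (i) The weight of (3.29) is `χ^{(k)}·exp[…]` with `χ^{(k)}` a characteristic function: Bałaban's
`(δ/δA)χ^{(k)}` is formal (a boundary term); the theorems here are for `H ∈ C¹_b` — they apply literally to a smooth cutoff and
to the factor `exp[𝐏^{(k)} + {𝐄_k…}]` (bounded analytic on the domain cut out by `χ^{(k)}`, (2.19)–(2.23)), and the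
`t`-dependence of `H_t` through `tA_k` is a parameter (the identity is proved for each fixed weight).  (ii) The identification
of `Q⁻¹ = C^{(k)}(Λ_{k+1})`, `w₀ = C*Δ^{(k)}CA_k` with Bałaban's operators, and the first equality (FTC, item (a)), are not
restated (`B14InterpolationMeasure`, `B14Interpolation`).  (iii) No claim about which terms "contribute to 𝐁^{(k+1)} only".
Related tree material (not imported; different measures/statements): `Analysis/UnboundedOperators/HeatKernelGaussianIBP`
(Stein's identity for the isotropic heat-kernel measure on an inner-product space), `B13GaugeDevices.integral_linear_shift`
(B13 (2.5), the integral form of the translation (9.1.27)).  No `sorry`.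
-/

open MeasureTheory Matrix Real Filter Topology
open scoped Matrix MatrixOrder ComplexOrder

namespace Literature.MathematicalPhysics.QuantumFieldTheory.Balaban1983to89.B14.Eq328GaussianIBP

variable {ι : Type*} [Fintype ι]

/-! ## §1 Calculus of the Gaussian density `ρ_Q(v) = exp(−½ vᵀQv)` on `ι → ℝ` -/

/-- The quadratic form `v ↦ vᵀQv` on `ι → ℝ` is Fréchet differentiable at every `x`, with derivative
`u ↦ xᵀQu + (Qx)ᵀu` (ingredient of `δ/δφ` of the Gaussian density in (9.1.28)). [folklore]
[cite: GlimmJaffe1987, §9.1 (9.1.28)] -/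
theorem hasFDerivAt_quadForm (Q : Matrix ι ι ℝ) (x : ι → ℝ) :
    ∃ D : (ι → ℝ) →L[ℝ] ℝ, HasFDerivAt (fun v : ι → ℝ => v ⬝ᵥ Q *ᵥ v) D x ∧
      ∀ u, D u = x ⬝ᵥ Q *ᵥ u + (Q *ᵥ x) ⬝ᵥ u := by
  set T : (ι → ℝ) →L[ℝ] (ι → ℝ) := LinearMap.toContinuousLinearMap (Matrix.mulVecLin Q) with hTdef
  have hT : ∀ v, T v = Q *ᵥ v := fun v => by simp [hTdef]
  set P : ι → (ι → ℝ) →L[ℝ] ℝ := fun i => ContinuousLinearMap.proj i with hPdef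
  have hP : ∀ i (v : ι → ℝ), P i v = v i := fun i v => rfl
  refine ⟨∑ i, (x i • ((P i).comp T) + (T x) i • P i), ?_, ?_⟩
  · have h : ∀ i ∈ (Finset.univ : Finset ι), HasFDerivAt (fun v : ι → ℝ => v i * (T v) i)
        (x i • ((P i).comp T) + (T x) i • P i) x := by
      intro i _
      have h1 : HasFDerivAt (fun v : ι → ℝ => v i) (P i) x := hasFDerivAt_apply i x
      have h2 : HasFDerivAt (fun v : ι → ℝ => (T v) i) ((P i).comp T) x :=
        ((P i).comp T).hasFDerivAt
      exact h1.fun_mul h2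
    have hs := HasFDerivAt.fun_sum h
    have hfun : (fun v : ι → ℝ => v ⬝ᵥ Q *ᵥ v) = fun y => ∑ i, y i * (T y) i := by
      funext y
      simp only [hT, dotProduct]
    rw [hfun]
    exact hs
  · intro u
    simp only [_root_.sum_apply, _root_.add_apply, _root_.smul_apply, ContinuousLinearMap.comp_apply, hT, hP,
      smul_eq_mul, dotProduct, Finset.sum_add_distrib]

/-- A linear functional `v ↦ ⟨v, w₀⟩` (the `φ(f)` of (9.1.28), the linear tilt of (3.29)) is its own derivative. [folklore]
[cite: GlimmJaffe1987, §9.1 (9.1.28)] -/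
theorem hasFDerivAt_dotProduct_const (w₀ x : ι → ℝ) :
    ∃ L : (ι → ℝ) →L[ℝ] ℝ, HasFDerivAt (fun v : ι → ℝ => v ⬝ᵥ w₀) L x ∧ ∀ u, L u = u ⬝ᵥ w₀ := by
  refine ⟨∑ i, w₀ i • (ContinuousLinearMap.proj i : (ι → ℝ) →L[ℝ] ℝ), ?_, fun u => ?_⟩
  · have h : ∀ i ∈ (Finset.univ : Finset ι), HasFDerivAt (fun v : ι → ℝ => v i * w₀ i)
        (w₀ i • (ContinuousLinearMap.proj i : (ι → ℝ) →L[ℝ] ℝ)) x :=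
      fun i _ => (hasFDerivAt_apply i x).mul_const (w₀ i)
    have hs := HasFDerivAt.fun_sum h
    have hfun : (fun v : ι → ℝ => v ⬝ᵥ w₀) = fun v => ∑ i, v i * w₀ i := by
      funext v
      simp only [dotProduct]
    rw [hfun]
    exact hs
  · simp only [_root_.sum_apply, _root_.smul_apply, ContinuousLinearMap.proj_apply, smul_eq_mul, dotProduct]
    exact Finset.sum_congr rfl fun i _ => mul_comm _ _

/-- For a symmetric `Q`: `(Qx)ᵀu = xᵀQu`. [folklore] -/
private theorem mulVec_dotProduct_of_isSymm {Q : Matrix ι ι ℝ} (hQ : Q.IsSymm) (x u : ι → ℝ) :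
    (Q *ᵥ x) ⬝ᵥ u = x ⬝ᵥ Q *ᵥ u := by
  rw [dotProduct_comm, dotProduct_mulVec, ← mulVec_transpose, hQ.eq, dotProduct_comm]

/-- The Gaussian density `ρ_Q(v) = e^{−½vᵀQv}` of a symmetric `Q` is differentiable with
`Dρ_Q(x)u = −(xᵀQu) ρ_Q(x)` — the identity `∂_{Cf}(dφ_C-density) = −φ(f)·density` behind (9.1.28). [folklore]
[cite: GlimmJaffe1987, §9.1 (9.1.28)] -/
theorem hasFDerivAt_gaussDensity (Q : Matrix ι ι ℝ) (hQ : Q.IsSymm) (x : ι → ℝ) :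
    ∃ D : (ι → ℝ) →L[ℝ] ℝ, HasFDerivAt (fun v : ι → ℝ => Real.exp (-(1/2 : ℝ) * (v ⬝ᵥ Q *ᵥ v))) D x ∧
      ∀ u, D u = -(x ⬝ᵥ Q *ᵥ u) * Real.exp (-(1/2 : ℝ) * (x ⬝ᵥ Q *ᵥ x)) := by
  obtain ⟨D₀, hD₀, hD₀u⟩ := hasFDerivAt_quadForm Q x
  have h1 : HasFDerivAt (fun v : ι → ℝ => -(1/2 : ℝ) * (v ⬝ᵥ Q *ᵥ v)) ((-(1/2 : ℝ)) • D₀) x :=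
    hD₀.const_mul (-(1/2 : ℝ))
  have h2 := (Real.hasDerivAt_exp (-(1/2 : ℝ) * (x ⬝ᵥ Q *ᵥ x))).comp_hasFDerivAt x h1
  refine ⟨_, h2, fun u => ?_⟩
  simp only [_root_.smul_apply, smul_eq_mul, hD₀u, mulVec_dotProduct_of_isSymm hQ]
  ring

/-- The Gaussian density is differentiable (no symmetry needed). [folklore] [cite: GlimmJaffe1987, §9.1 (9.1.28)] -/
theorem differentiable_gaussDensity (Q : Matrix ι ι ℝ) :
    Differentiable ℝ (fun v : ι → ℝ => Real.exp (-(1/2 : ℝ) * (v ⬝ᵥ Q *ᵥ v))) := fun x => by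
  obtain ⟨D, hD, -⟩ := hasFDerivAt_quadForm Q x
  exact ((Real.hasDerivAt_exp _).comp_hasFDerivAt x (hD.const_mul (-(1/2 : ℝ)))).differentiableAt

/-- The directional derivative of the Gaussian density: `∂_u ρ_Q(x) = −(xᵀQu) ρ_Q(x)` (`Q` symmetric) — with `u = Q⁻¹w`
this is `∂_{Cw}ρ = −⟨·,w⟩ρ`, the pointwise identity integrated in (9.1.28). [folklore] [cite: GlimmJaffe1987, §9.1 (9.1.28)] -/
theorem fderiv_gaussDensity_apply (Q : Matrix ι ι ℝ) (hQ : Q.IsSymm) (x u : ι → ℝ) :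
    fderiv ℝ (fun v : ι → ℝ => Real.exp (-(1/2 : ℝ) * (v ⬝ᵥ Q *ᵥ v))) x u =
      -(x ⬝ᵥ Q *ᵥ u) * Real.exp (-(1/2 : ℝ) * (x ⬝ᵥ Q *ᵥ x)) := by
  obtain ⟨D, hD, hDu⟩ := hasFDerivAt_gaussDensity Q hQ x
  rw [hD.fderiv, hDu]

omit [Fintype ι] in
/-- A positive definite real matrix is symmetric. [folklore] -/
private theorem isSymm_of_posDef {Q : Matrix ι ι ℝ} (hQ : Q.PosDef) : Q.IsSymm := by
  have h := hQ.isHermitian.eq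
  rw [Matrix.conjTranspose_eq_transpose_of_trivial] at h
  exact h

/-! ## §2 Moment integrability -/

/-- `w ↦ w_i e^{−|w|²/2}` is integrable on `ι → ℝ` (product structure, `∫ |x|e^{−x²/2} < ∞`): the first Gaussian moment
is finite, so the left-hand side `∫ φ(f)A dφ_C` of (9.1.28) exists for bounded `A`. [folklore] [cite: GlimmJaffe1987, §9.1 (9.1.28)] -/
theorem integrable_coord_mul_gaussStd (i : ι) :
    Integrable (fun w : ι → ℝ => w i * Real.exp (-(1/2 : ℝ) * (w ⬝ᵥ w))) := by
  classical
  let f : ι → ℝ → ℝ := fun j x => (if j = i then x else 1) * Real.exp (-(1/2 : ℝ) * x ^ 2)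
  have hf : ∀ j, Integrable (f j) := by
    intro j
    by_cases h : j = i
    · simp only [f, h, if_true]
      exact integrable_mul_exp_neg_mul_sq (by norm_num : (0 : ℝ) < 1/2)
    · simp only [f, h, if_false, one_mul]
      exact integrable_exp_neg_mul_sq (by norm_num : (0 : ℝ) < 1/2)
  have hexp : ∀ w : ι → ℝ, Real.exp (-(1/2 : ℝ) * (w ⬝ᵥ w)) = ∏ j, Real.exp (-(1/2 : ℝ) * (w j) ^ 2) := by
    intro w
    rw [← Real.exp_sum, dotProduct, Finset.mul_sum]
    congr 1
    exact Finset.sum_congr rfl fun j _ => by ring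
  have key : ∀ w : ι → ℝ, w i * Real.exp (-(1/2 : ℝ) * (w ⬝ᵥ w)) = ∏ j, f j (w j) := by
    intro w
    have h1 : (∏ j, f j (w j)) =
        (∏ j, (if j = i then w j else (1 : ℝ))) * ∏ j, Real.exp (-(1/2 : ℝ) * (w j) ^ 2) := by
      simp only [f]
      rw [Finset.prod_mul_distrib]
    have h2 : (∏ j, (if j = i then w j else (1 : ℝ))) = w i := by
      rw [Finset.prod_ite_eq']
      simp
    rw [h1, h2, hexp]
  simp_rw [key]
  exact Integrable.fintype_prod (f := f) hf

/-- `w ↦ ⟨w, w'⟩ e^{−|w|²/2}` is integrable on `ι → ℝ` (first moment of the isotropic Gaussian; existence of `∫ φ(f) dφ_1`).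
[folklore] [cite: GlimmJaffe1987, §9.1 (9.1.28)] -/
theorem integrable_dotProduct_mul_gaussStd (w' : ι → ℝ) :
    Integrable (fun w : ι → ℝ => (w ⬝ᵥ w') * Real.exp (-(1/2 : ℝ) * (w ⬝ᵥ w))) := by
  have h : ∀ w : ι → ℝ, (w ⬝ᵥ w') * Real.exp (-(1/2 : ℝ) * (w ⬝ᵥ w)) =
      ∑ i, w' i * (w i * Real.exp (-(1/2 : ℝ) * (w ⬝ᵥ w))) := by
    intro w
    have : w ⬝ᵥ w' = ∑ i, w i * w' i := rfl
    rw [this, Finset.sum_mul]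
    exact Finset.sum_congr rfl fun i _ => by ring
  simp_rw [h]
  exact integrable_finsetSum _ fun i _ => (integrable_coord_mul_gaussStd i).const_mul (w' i)

/-- For positive definite `Q`, `v ↦ ⟨v, w⟩ e^{−½vᵀQv}` is integrable on `ι → ℝ` (`Q = BᵀB`, change of variables
`x = Bv`, `Beta.GaussianIntegral.integrable_comp_mulVec`): existence of `∫ φ(f) dφ_C` in (9.1.28). [folklore]
[cite: GlimmJaffe1987, §9.1 (9.1.28)] -/
theorem integrable_dotProduct_mul_gaussDensity (Q : Matrix ι ι ℝ) (hQ : Q.PosDef) (w : ι → ℝ) :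
    Integrable (fun v : ι → ℝ => (v ⬝ᵥ w) * Real.exp (-(1/2 : ℝ) * (v ⬝ᵥ Q *ᵥ v))) := by
  classical
  obtain ⟨B, hB⟩ : ∃ B : Matrix ι ι ℝ, Q = Bᵀ * B := by
    obtain ⟨B, hB⟩ := CStarAlgebra.nonneg_iff_eq_star_mul_self.mp hQ.posSemidef.nonneg
    exact ⟨B, by rwa [Matrix.star_eq_conjTranspose, Matrix.conjTranspose_eq_transpose_of_trivial] at hB⟩
  have hdetB : B.det ≠ 0 := by
    intro h
    have h' := hQ.det_pos
    rw [hB, det_mul, det_transpose, h] at h'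
    simp at h'
  have hBu : IsUnit B.det := isUnit_iff_ne_zero.2 hdetB
  let g : (ι → ℝ) → ℝ := fun x => (x ⬝ᵥ (w ᵥ* B⁻¹)) * Real.exp (-(1/2 : ℝ) * (x ⬝ᵥ x))
  have hg : Integrable g := integrable_dotProduct_mul_gaussStd (w ᵥ* B⁻¹)
  have key : ∀ v : ι → ℝ, (v ⬝ᵥ w) * Real.exp (-(1/2 : ℝ) * (v ⬝ᵥ Q *ᵥ v)) = g (B *ᵥ v) := by
    intro v
    simp only [g]
    rw [hB, Beta.GaussianIntegral.dotProduct_transpose_mul_self_mulVec]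
    congr 1
    rw [dotProduct_comm (B *ᵥ v), ← dotProduct_mulVec, mulVec_mulVec, Matrix.nonsing_inv_mul _ hBu, one_mulVec,
      dotProduct_comm]
  simp_rw [key]
  exact Beta.GaussianIntegral.integrable_comp_mulVec B hdetB hg

/-! ## §3 Gaussian integration by parts (Glimm–Jaffe (9.1.28) in finite dimensions) -/

/-- Integration-by-parts core on `ι → ℝ`: if `∂_u ρ = −ℓρ` pointwise, then `∫ ℓ G ρ = ∫ (∂_u G) ρ` as soon as the three
products are integrable (Mathlib's whole-space integration by parts, no boundary terms) — the abstract form of the proof of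
(9.1.28) ("proved in Section 6.3" by integration by parts). [folklore] [cite: GlimmJaffe1987, §9.1 (9.1.28)] -/
theorem integral_mul_mul_eq_integral_fderiv_mul {ρ ℓ G : (ι → ℝ) → ℝ} {u : ι → ℝ}
    (hρd : Differentiable ℝ ρ) (hρ' : ∀ v, fderiv ℝ ρ v u = -(ℓ v * ρ v)) (hG : ∀ v, DifferentiableAt ℝ G v)
    (h1 : Integrable fun v => ℓ v * G v * ρ v) (h2 : Integrable fun v => fderiv ℝ G v u * ρ v)
    (h3 : Integrable fun v => G v * ρ v) :
    ∫ v, ℓ v * G v * ρ v = ∫ v, fderiv ℝ G v u * ρ v := by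
  have hB : Integrable fun v => G v * fderiv ℝ ρ v u := by
    have : (fun v => G v * fderiv ℝ ρ v u) = fun v => -(ℓ v * G v * ρ v) := by
      funext v
      rw [hρ' v]
      ring
    rw [this]
    exact h1.neg
  have hibp := integral_mul_fderiv_eq_neg_fderiv_mul_of_integrable h2 hB h3 (fun v _ => hG v)
    (fun v _ => hρd v)
  calc ∫ v, ℓ v * G v * ρ v = ∫ v, -(G v * fderiv ℝ ρ v u) := by
        congr 1
        funext v
        rw [hρ' v]
        ring
    _ = -∫ v, G v * fderiv ℝ ρ v u := integral_neg _
    _ = ∫ v, fderiv ℝ G v u * ρ v := by rw [hibp, neg_neg]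

variable [DecidableEq ι]

/-- **Gaussian integration by parts, precision form** (Glimm–Jaffe (9.1.28) `∫ φ(f)A dφ_C = ∫ ⟨Cf, δA/δφ⟩ dφ_C` on `ι → ℝ`,
`C = Q⁻¹`): for `Q` positive definite, `G` differentiable, and the three products integrable,
`∫ ⟨v,w⟩ G(v) e^{−½vᵀQv} dv = ∫ (∂_{Q⁻¹w}G)(v) e^{−½vᵀQv} dv`.
[cite: GlimmJaffe1987, §9.1 (9.1.28)] [cite: Balaban1988Convergent, (3.28) p.272] -/
theorem integral_dotProduct_mul_mul_gaussDensity_of_integrable (Q : Matrix ι ι ℝ) (hQ : Q.PosDef)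
    {G : (ι → ℝ) → ℝ} (hG : ∀ v, DifferentiableAt ℝ G v) (w : ι → ℝ)
    (h1 : Integrable fun v : ι → ℝ => (v ⬝ᵥ w) * G v * Real.exp (-(1/2 : ℝ) * (v ⬝ᵥ Q *ᵥ v)))
    (h2 : Integrable fun v : ι → ℝ => fderiv ℝ G v (Q⁻¹ *ᵥ w) * Real.exp (-(1/2 : ℝ) * (v ⬝ᵥ Q *ᵥ v)))
    (h3 : Integrable fun v : ι → ℝ => G v * Real.exp (-(1/2 : ℝ) * (v ⬝ᵥ Q *ᵥ v))) :
    ∫ v : ι → ℝ, (v ⬝ᵥ w) * G v * Real.exp (-(1/2 : ℝ) * (v ⬝ᵥ Q *ᵥ v)) =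
      ∫ v : ι → ℝ, fderiv ℝ G v (Q⁻¹ *ᵥ w) * Real.exp (-(1/2 : ℝ) * (v ⬝ᵥ Q *ᵥ v)) := by
  have hQs : Q.IsSymm := isSymm_of_posDef hQ
  have hQu : IsUnit Q.det := isUnit_iff_ne_zero.2 hQ.det_pos.ne'
  have hw : Q *ᵥ (Q⁻¹ *ᵥ w) = w := by rw [mulVec_mulVec, Matrix.mul_nonsing_inv _ hQu, one_mulVec]
  have hρ' : ∀ v : ι → ℝ, fderiv ℝ (fun v : ι → ℝ => Real.exp (-(1/2 : ℝ) * (v ⬝ᵥ Q *ᵥ v))) v (Q⁻¹ *ᵥ w)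
      = -((v ⬝ᵥ w) * Real.exp (-(1/2 : ℝ) * (v ⬝ᵥ Q *ᵥ v))) := fun v => by
    rw [fderiv_gaussDensity_apply Q hQs, hw]
    ring
  exact integral_mul_mul_eq_integral_fderiv_mul (differentiable_gaussDensity Q) hρ' hG h1 h2 h3

/-- **Gaussian integration by parts (Stein / Wick) for bounded `C¹` test functions**: `Q` positive definite, `G ∈ C¹` with
`G` and `DG` bounded ⇒ `∫ ⟨v,w⟩ G(v) e^{−½vᵀQv} dv = ∫ (∂_{Q⁻¹w}G)(v) e^{−½vᵀQv} dv` (all integrabilities discharged).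
[cite: GlimmJaffe1987, §9.1 (9.1.28)] -/
theorem integral_dotProduct_mul_mul_gaussDensity (Q : Matrix ι ι ℝ) (hQ : Q.PosDef)
    {G : (ι → ℝ) → ℝ} (hG : ContDiff ℝ 1 G) {C₀ C₁ : ℝ} (h0 : ∀ v, ‖G v‖ ≤ C₀) (h1 : ∀ v, ‖fderiv ℝ G v‖ ≤ C₁)
    (w : ι → ℝ) :
    ∫ v : ι → ℝ, (v ⬝ᵥ w) * G v * Real.exp (-(1/2 : ℝ) * (v ⬝ᵥ Q *ᵥ v)) =
      ∫ v : ι → ℝ, fderiv ℝ G v (Q⁻¹ *ᵥ w) * Real.exp (-(1/2 : ℝ) * (v ⬝ᵥ Q *ᵥ v)) := by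
  have hGd : Differentiable ℝ G := hG.differentiable one_ne_zero
  have hGc : Continuous G := hG.continuous
  have hG'c : Continuous fun v => fderiv ℝ G v (Q⁻¹ *ᵥ w) :=
    (hG.continuous_fderiv one_ne_zero).clm_apply continuous_const
  have hρ := Beta.GaussianIntegral.integrable_exp_neg_half_quadForm Q hQ
  have i1 : Integrable fun v : ι → ℝ => (v ⬝ᵥ w) * G v * Real.exp (-(1/2 : ℝ) * (v ⬝ᵥ Q *ᵥ v)) := by
    have h := (integrable_dotProduct_mul_gaussDensity Q hQ w).bdd_mul hGc.aestronglyMeasurable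
      (Eventually.of_forall h0)
    have e : (fun v : ι → ℝ => (v ⬝ᵥ w) * G v * Real.exp (-(1/2 : ℝ) * (v ⬝ᵥ Q *ᵥ v))) =
        fun v => G v * ((v ⬝ᵥ w) * Real.exp (-(1/2 : ℝ) * (v ⬝ᵥ Q *ᵥ v))) := by
      funext v
      ring
    rw [e]
    exact h
  have i2 : Integrable fun v : ι → ℝ => fderiv ℝ G v (Q⁻¹ *ᵥ w) * Real.exp (-(1/2 : ℝ) * (v ⬝ᵥ Q *ᵥ v)) :=
    hρ.bdd_mul hG'c.aestronglyMeasurable (Eventually.of_forall fun v =>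
      ((fderiv ℝ G v).le_opNorm _).trans (mul_le_mul_of_nonneg_right (h1 v) (norm_nonneg _)))
  have i3 : Integrable fun v : ι → ℝ => G v * Real.exp (-(1/2 : ℝ) * (v ⬝ᵥ Q *ᵥ v)) :=
    hρ.bdd_mul hGc.aestronglyMeasurable (Eventually.of_forall h0)
  exact integral_dotProduct_mul_mul_gaussDensity_of_integrable Q hQ (fun v => hGd v) w i1 i2 i3

/-- **Covariance form** (the verbatim shape `⟨Cf, δ/δφ⟩` of (9.1.28)): `C` positive definite, density `e^{−½vᵀC⁻¹v}`,
`G` differentiable with the three products integrable ⇒ `∫ ⟨v,w⟩ G ρ = ∫ (∂_{Cw}G) ρ`.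
[cite: GlimmJaffe1987, §9.1 (9.1.28)] [cite: Balaban1988Convergent, (3.28)–(3.29) p.272] -/
theorem integral_dotProduct_mul_mul_gaussDensity_cov_of_integrable (C : Matrix ι ι ℝ) (hC : C.PosDef)
    {G : (ι → ℝ) → ℝ} (hG : ∀ v, DifferentiableAt ℝ G v) (w : ι → ℝ)
    (h1 : Integrable fun v : ι → ℝ => (v ⬝ᵥ w) * G v * Real.exp (-(1/2 : ℝ) * (v ⬝ᵥ C⁻¹ *ᵥ v)))
    (h2 : Integrable fun v : ι → ℝ => fderiv ℝ G v (C *ᵥ w) * Real.exp (-(1/2 : ℝ) * (v ⬝ᵥ C⁻¹ *ᵥ v)))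
    (h3 : Integrable fun v : ι → ℝ => G v * Real.exp (-(1/2 : ℝ) * (v ⬝ᵥ C⁻¹ *ᵥ v))) :
    ∫ v : ι → ℝ, (v ⬝ᵥ w) * G v * Real.exp (-(1/2 : ℝ) * (v ⬝ᵥ C⁻¹ *ᵥ v)) =
      ∫ v : ι → ℝ, fderiv ℝ G v (C *ᵥ w) * Real.exp (-(1/2 : ℝ) * (v ⬝ᵥ C⁻¹ *ᵥ v)) := by
  have hCu : IsUnit C.det := isUnit_iff_ne_zero.2 hC.det_pos.ne'
  have hinv : C⁻¹⁻¹ = C := Matrix.nonsing_inv_nonsing_inv C hCu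
  have h := integral_dotProduct_mul_mul_gaussDensity_of_integrable C⁻¹ hC.inv hG w h1 (by rw [hinv]; exact h2) h3
  rw [hinv] at h
  exact h

/-- **Covariance form for bounded `C¹` test functions**: `∫ ⟨v,w⟩ G e^{−½vᵀC⁻¹v} dv = ∫ (∂_{Cw}G) e^{−½vᵀC⁻¹v} dv`.
[cite: GlimmJaffe1987, §9.1 (9.1.28)] -/
theorem integral_dotProduct_mul_mul_gaussDensity_cov (C : Matrix ι ι ℝ) (hC : C.PosDef)
    {G : (ι → ℝ) → ℝ} (hG : ContDiff ℝ 1 G) {C₀ C₁ : ℝ} (h0 : ∀ v, ‖G v‖ ≤ C₀) (h1 : ∀ v, ‖fderiv ℝ G v‖ ≤ C₁)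
    (w : ι → ℝ) :
    ∫ v : ι → ℝ, (v ⬝ᵥ w) * G v * Real.exp (-(1/2 : ℝ) * (v ⬝ᵥ C⁻¹ *ᵥ v)) =
      ∫ v : ι → ℝ, fderiv ℝ G v (C *ᵥ w) * Real.exp (-(1/2 : ℝ) * (v ⬝ᵥ C⁻¹ *ᵥ v)) := by
  have hCu : IsUnit C.det := isUnit_iff_ne_zero.2 hC.det_pos.ne'
  have hinv : C⁻¹⁻¹ = C := Matrix.nonsing_inv_nonsing_inv C hCu
  have h := integral_dotProduct_mul_mul_gaussDensity C⁻¹ hC.inv hG h0 h1 w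
  rw [hinv] at h
  exact h

/-! ## §4 The (3.28)–(3.29) step: linear tilt, completing the square, absorption of the linear term -/

/-- **Completing the square** (translation of a Gaussian measure, Glimm–Jaffe (9.1.27), pointwise on `ι → ℝ`): for `C`
positive definite, `e^{−t⟨v,w₀⟩} e^{−½vᵀC⁻¹v} = e^{(t²/2)⟨w₀,Cw₀⟩} e^{−½(v+tCw₀)ᵀC⁻¹(v+tCw₀)}`.
[cite: GlimmJaffe1987, §9.1 (9.1.27)] -/
theorem gaussDensity_linear_tilt (C : Matrix ι ι ℝ) (hC : C.PosDef) (w₀ : ι → ℝ) (t : ℝ) (v : ι → ℝ) :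
    Real.exp (-(t * (v ⬝ᵥ w₀))) * Real.exp (-(1/2 : ℝ) * (v ⬝ᵥ C⁻¹ *ᵥ v)) =
      Real.exp (t ^ 2 / 2 * (w₀ ⬝ᵥ C *ᵥ w₀)) *
        Real.exp (-(1/2 : ℝ) * ((v + t • C *ᵥ w₀) ⬝ᵥ C⁻¹ *ᵥ (v + t • C *ᵥ w₀))) := by
  have hCu : IsUnit C.det := isUnit_iff_ne_zero.2 hC.det_pos.ne'
  have hCis : C⁻¹.IsSymm := isSymm_of_posDef hC.inv
  have h1 : C⁻¹ *ᵥ (C *ᵥ w₀) = w₀ := by rw [mulVec_mulVec, Matrix.nonsing_inv_mul _ hCu, one_mulVec]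
  have h2 : (C *ᵥ w₀) ⬝ᵥ C⁻¹ *ᵥ v = v ⬝ᵥ w₀ := by
    rw [← mulVec_dotProduct_of_isSymm hCis, h1, dotProduct_comm]
  have h3 : (C *ᵥ w₀) ⬝ᵥ w₀ = w₀ ⬝ᵥ C *ᵥ w₀ := dotProduct_comm _ _
  have hexp : (v + t • C *ᵥ w₀) ⬝ᵥ C⁻¹ *ᵥ (v + t • C *ᵥ w₀) =
      v ⬝ᵥ C⁻¹ *ᵥ v + 2 * t * (v ⬝ᵥ w₀) + t ^ 2 * (w₀ ⬝ᵥ C *ᵥ w₀) := by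
    simp only [mulVec_add, mulVec_smul, add_dotProduct, dotProduct_add, dotProduct_smul, smul_dotProduct, h1, h2, h3,
      smul_eq_mul]
    ring
  rw [← Real.exp_add, ← Real.exp_add, hexp]
  congr 1
  ring

/-- The linearly tilted Gaussian `v ↦ e^{−t⟨v,w₀⟩} e^{−½vᵀC⁻¹v}` is integrable (a translate of the Gaussian).
[cite: GlimmJaffe1987, §9.1 (9.1.27)] -/
theorem integrable_linear_tilt_gaussDensity (C : Matrix ι ι ℝ) (hC : C.PosDef) (w₀ : ι → ℝ) (t : ℝ) :
    Integrable fun v : ι → ℝ => Real.exp (-(t * (v ⬝ᵥ w₀))) * Real.exp (-(1/2 : ℝ) * (v ⬝ᵥ C⁻¹ *ᵥ v)) := by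
  have h := ((Beta.GaussianIntegral.integrable_exp_neg_half_quadForm C⁻¹ hC.inv).comp_add_right
    (t • C *ᵥ w₀)).const_mul (Real.exp (t ^ 2 / 2 * (w₀ ⬝ᵥ C *ᵥ w₀)))
  exact h.congr (Eventually.of_forall fun v => (gaussDensity_linear_tilt C hC w₀ t v).symm)

/-- `v ↦ ⟨v,w⟩ e^{−t⟨v,w₀⟩} e^{−½vᵀC⁻¹v}` is integrable (first moment of a translated Gaussian).
[cite: GlimmJaffe1987, §9.1 (9.1.27)] -/
theorem integrable_dotProduct_mul_linear_tilt_gaussDensity (C : Matrix ι ι ℝ) (hC : C.PosDef) (w₀ w : ι → ℝ)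
    (t : ℝ) :
    Integrable fun v : ι → ℝ =>
      (v ⬝ᵥ w) * (Real.exp (-(t * (v ⬝ᵥ w₀))) * Real.exp (-(1/2 : ℝ) * (v ⬝ᵥ C⁻¹ *ᵥ v))) := by
  have g1 := (integrable_dotProduct_mul_gaussDensity C⁻¹ hC.inv w).comp_add_right (t • C *ᵥ w₀)
  have g2 := (Beta.GaussianIntegral.integrable_exp_neg_half_quadForm C⁻¹ hC.inv).comp_add_right (t • C *ᵥ w₀)
  have g3 := (g1.sub (g2.const_mul ((t • C *ᵥ w₀) ⬝ᵥ w))).const_mul (Real.exp (t ^ 2 / 2 * (w₀ ⬝ᵥ C *ᵥ w₀)))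
  have key : ∀ v : ι → ℝ,
      Real.exp (t ^ 2 / 2 * (w₀ ⬝ᵥ C *ᵥ w₀)) *
          (((v + t • C *ᵥ w₀) ⬝ᵥ w) *
              Real.exp (-(1/2 : ℝ) * ((v + t • C *ᵥ w₀) ⬝ᵥ C⁻¹ *ᵥ (v + t • C *ᵥ w₀))) -
            ((t • C *ᵥ w₀) ⬝ᵥ w) *
              Real.exp (-(1/2 : ℝ) * ((v + t • C *ᵥ w₀) ⬝ᵥ C⁻¹ *ᵥ (v + t • C *ᵥ w₀)))) =
        (v ⬝ᵥ w) * (Real.exp (-(t * (v ⬝ᵥ w₀))) * Real.exp (-(1/2 : ℝ) * (v ⬝ᵥ C⁻¹ *ᵥ v))) := by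
    intro v
    rw [gaussDensity_linear_tilt C hC w₀ t v, add_dotProduct]
    ring
  exact g3.congr (Eventually.of_forall key)

omit [DecidableEq ι] in
/-- Derivative of the tilted weight `v ↦ e^{−t⟨v,w₀⟩} H(v)`:
`D(e^{−t⟨·,w₀⟩}H)(x)u = e^{−t⟨x,w₀⟩}H(x)·(−t⟨u,w₀⟩) + e^{−t⟨x,w₀⟩}DH(x)u` — the `δ/δA` of the weight of (3.29)
(`δA/δφ − AδV/δφ` of (9.1.32)). [folklore] [cite: Balaban1988Convergent, (3.29) p.272] [cite: GlimmJaffe1987, §9.1 (9.1.32)] -/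
theorem hasFDerivAt_tilt (w₀ : ι → ℝ) (t : ℝ) {H : (ι → ℝ) → ℝ} {H' : (ι → ℝ) →L[ℝ] ℝ} {x : ι → ℝ}
    (hH : HasFDerivAt H H' x) :
    ∃ D : (ι → ℝ) →L[ℝ] ℝ, HasFDerivAt (fun v : ι → ℝ => Real.exp (-(t * (v ⬝ᵥ w₀))) * H v) D x ∧
      ∀ u, D u = Real.exp (-(t * (x ⬝ᵥ w₀))) * H x * (-(t * (u ⬝ᵥ w₀))) +
        Real.exp (-(t * (x ⬝ᵥ w₀))) * H' u := by
  obtain ⟨L, hL, hLu⟩ := hasFDerivAt_dotProduct_const w₀ x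
  have hE0 : HasFDerivAt (fun v : ι → ℝ => -(t * (v ⬝ᵥ w₀))) (-(t • L)) x := (hL.const_mul t).neg
  have hE : HasFDerivAt (fun v : ι → ℝ => Real.exp (-(t * (v ⬝ᵥ w₀))))
      (Real.exp (-(t * (x ⬝ᵥ w₀))) • (-(t • L))) x :=
    (Real.hasDerivAt_exp _).comp_hasFDerivAt x hE0
  refine ⟨_, hE.fun_mul hH, fun u => ?_⟩
  simp only [_root_.add_apply, _root_.smul_apply, smul_eq_mul, _root_.neg_apply, hLu]
  ring

/-- **(3.28), second equality — the tilted Gaussian integration by parts** (Glimm–Jaffe (9.1.32) for the tilt of (3.29):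
a linear term `−t⟨v,w₀⟩` plus `log H`).  For `C` positive definite, `H ∈ C¹` bounded with bounded derivative, all
`w₀, w ∈ ℝ^ι`, `t ∈ ℝ`:
`∫ ⟨v,w⟩ e^{−t⟨v,w₀⟩}H(v) e^{−½vᵀC⁻¹v} dv = −t⟨Cw, w₀⟩ ∫ e^{−t⟨v,w₀⟩}H e^{−½vᵀC⁻¹v} + ∫ e^{−t⟨v,w₀⟩}(∂_{Cw}H) e^{−½vᵀC⁻¹v}`.
In print `H = χ^{(k)} exp[𝐏^{(k)}(g_k,(tA_k,A)) + {𝐄_k…}]`, `w₀ = C*Δ^{(k)}CA_k`, `C = C^{(k)}(Λ_{k+1})`, and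
`∂_{Cw}H = H·⟨Cw, (δ/δA)(χ^{(k)} + 𝐏^{(k)} + 𝐄_k)⟩` formally.
[cite: Balaban1988Convergent, (3.28)–(3.29) p.272] [cite: GlimmJaffe1987, §9.1 (9.1.32)] -/
theorem eq328_tilted_ibp (C : Matrix ι ι ℝ) (hC : C.PosDef) {H : (ι → ℝ) → ℝ} (hH : ContDiff ℝ 1 H) {K₀ K₁ : ℝ}
    (h0 : ∀ v, ‖H v‖ ≤ K₀) (h1 : ∀ v, ‖fderiv ℝ H v‖ ≤ K₁) (w₀ w : ι → ℝ) (t : ℝ) :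
    ∫ v : ι → ℝ, (v ⬝ᵥ w) * (Real.exp (-(t * (v ⬝ᵥ w₀))) * H v) * Real.exp (-(1/2 : ℝ) * (v ⬝ᵥ C⁻¹ *ᵥ v)) =
      -(t * ((C *ᵥ w) ⬝ᵥ w₀)) *
          (∫ v : ι → ℝ, Real.exp (-(t * (v ⬝ᵥ w₀))) * H v * Real.exp (-(1/2 : ℝ) * (v ⬝ᵥ C⁻¹ *ᵥ v))) +
        (∫ v : ι → ℝ, Real.exp (-(t * (v ⬝ᵥ w₀))) * fderiv ℝ H v (C *ᵥ w) *
          Real.exp (-(1/2 : ℝ) * (v ⬝ᵥ C⁻¹ *ᵥ v))) := by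
  have hHd : Differentiable ℝ H := hH.differentiable one_ne_zero
  have hHc : Continuous H := hH.continuous
  have hH'c : Continuous fun v => fderiv ℝ H v (C *ᵥ w) :=
    (hH.continuous_fderiv one_ne_zero).clm_apply continuous_const
  -- the tilted test function `G = e^{−t⟨·,w₀⟩} H` and its derivative along `Cw`
  have hGD : ∀ v : ι → ℝ, ∃ D : (ι → ℝ) →L[ℝ] ℝ,
      HasFDerivAt (fun v : ι → ℝ => Real.exp (-(t * (v ⬝ᵥ w₀))) * H v) D v ∧
      ∀ u, D u = Real.exp (-(t * (v ⬝ᵥ w₀))) * H v * (-(t * (u ⬝ᵥ w₀))) +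
        Real.exp (-(t * (v ⬝ᵥ w₀))) * fderiv ℝ H v u :=
    fun v => hasFDerivAt_tilt w₀ t (hHd v).hasFDerivAt
  have hGd : ∀ v : ι → ℝ, DifferentiableAt ℝ (fun v : ι → ℝ => Real.exp (-(t * (v ⬝ᵥ w₀))) * H v) v :=
    fun v => by
    obtain ⟨D, hD, -⟩ := hGD v
    exact hD.differentiableAt
  have hG' : ∀ v : ι → ℝ, fderiv ℝ (fun v : ι → ℝ => Real.exp (-(t * (v ⬝ᵥ w₀))) * H v) v (C *ᵥ w) =
      -(t * ((C *ᵥ w) ⬝ᵥ w₀)) * (Real.exp (-(t * (v ⬝ᵥ w₀))) * H v) +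
        Real.exp (-(t * (v ⬝ᵥ w₀))) * fderiv ℝ H v (C *ᵥ w) := fun v => by
    obtain ⟨D, hD, hDu⟩ := hGD v
    rw [hD.fderiv, hDu]
    ring
  -- integrability of the tilted pieces
  have hEρ := integrable_linear_tilt_gaussDensity C hC w₀ t
  have i3 : Integrable fun v : ι → ℝ =>
      Real.exp (-(t * (v ⬝ᵥ w₀))) * H v * Real.exp (-(1/2 : ℝ) * (v ⬝ᵥ C⁻¹ *ᵥ v)) := by
    have h := hEρ.bdd_mul hHc.aestronglyMeasurable (Eventually.of_forall h0)
    exact h.congr (Eventually.of_forall fun v => by ring)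
  have i1 : Integrable fun v : ι → ℝ => (v ⬝ᵥ w) * (Real.exp (-(t * (v ⬝ᵥ w₀))) * H v) *
      Real.exp (-(1/2 : ℝ) * (v ⬝ᵥ C⁻¹ *ᵥ v)) := by
    have h := (integrable_dotProduct_mul_linear_tilt_gaussDensity C hC w₀ w t).bdd_mul hHc.aestronglyMeasurable
      (Eventually.of_forall h0)
    exact h.congr (Eventually.of_forall fun v => by ring)
  have i2b : Integrable fun v : ι → ℝ =>
      Real.exp (-(t * (v ⬝ᵥ w₀))) * fderiv ℝ H v (C *ᵥ w) * Real.exp (-(1/2 : ℝ) * (v ⬝ᵥ C⁻¹ *ᵥ v)) := by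
    have h := hEρ.bdd_mul hH'c.aestronglyMeasurable (Eventually.of_forall fun v =>
      ((fderiv ℝ H v).le_opNorm _).trans (mul_le_mul_of_nonneg_right (h1 v) (norm_nonneg _)))
    exact h.congr (Eventually.of_forall fun v => by ring)
  have i2a : Integrable fun v : ι → ℝ => -(t * ((C *ᵥ w) ⬝ᵥ w₀)) *
      (Real.exp (-(t * (v ⬝ᵥ w₀))) * H v * Real.exp (-(1/2 : ℝ) * (v ⬝ᵥ C⁻¹ *ᵥ v))) := i3.const_mul _
  have i2 : Integrable fun v : ι → ℝ =>
      fderiv ℝ (fun v : ι → ℝ => Real.exp (-(t * (v ⬝ᵥ w₀))) * H v) v (C *ᵥ w) *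
        Real.exp (-(1/2 : ℝ) * (v ⬝ᵥ C⁻¹ *ᵥ v)) := by
    refine (i2a.add i2b).congr (Eventually.of_forall fun v => ?_)
    simp only [Pi.add_apply, hG' v]
    ring
  have i3' : Integrable fun v : ι → ℝ =>
      (Real.exp (-(t * (v ⬝ᵥ w₀))) * H v) * Real.exp (-(1/2 : ℝ) * (v ⬝ᵥ C⁻¹ *ᵥ v)) := i3
  -- Gaussian integration by parts, then split the derivative of the tilt
  have hibp := integral_dotProduct_mul_mul_gaussDensity_cov_of_integrable C hC
    (G := fun v : ι → ℝ => Real.exp (-(t * (v ⬝ᵥ w₀))) * H v) hGd w i1 i2 i3'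
  calc ∫ v : ι → ℝ, (v ⬝ᵥ w) * (Real.exp (-(t * (v ⬝ᵥ w₀))) * H v) * Real.exp (-(1/2 : ℝ) * (v ⬝ᵥ C⁻¹ *ᵥ v))
      = ∫ v : ι → ℝ, fderiv ℝ (fun v : ι → ℝ => Real.exp (-(t * (v ⬝ᵥ w₀))) * H v) v (C *ᵥ w) *
          Real.exp (-(1/2 : ℝ) * (v ⬝ᵥ C⁻¹ *ᵥ v)) := hibp
    _ = ∫ v : ι → ℝ, (-(t * ((C *ᵥ w) ⬝ᵥ w₀)) *
            (Real.exp (-(t * (v ⬝ᵥ w₀))) * H v * Real.exp (-(1/2 : ℝ) * (v ⬝ᵥ C⁻¹ *ᵥ v))) +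
          Real.exp (-(t * (v ⬝ᵥ w₀))) * fderiv ℝ H v (C *ᵥ w) * Real.exp (-(1/2 : ℝ) * (v ⬝ᵥ C⁻¹ *ᵥ v))) := by
        congr 1
        funext v
        rw [hG' v]
        ring
    _ = -(t * ((C *ᵥ w) ⬝ᵥ w₀)) *
          (∫ v : ι → ℝ, Real.exp (-(t * (v ⬝ᵥ w₀))) * H v * Real.exp (-(1/2 : ℝ) * (v ⬝ᵥ C⁻¹ *ᵥ v))) +
        (∫ v : ι → ℝ, Real.exp (-(t * (v ⬝ᵥ w₀))) * fderiv ℝ H v (C *ᵥ w) *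
          Real.exp (-(1/2 : ℝ) * (v ⬝ᵥ C⁻¹ *ᵥ v))) := by
        rw [integral_add i2a i2b, integral_const_mul]

/-- **(3.28), the printed case `w = w₀`** (the inserted linear functional IS the tilt direction `w₀ = C*Δ^{(k)}CA_k`):
with `K_t = e^{−t⟨·,w₀⟩}H`,  `∫ (−⟨v,w₀⟩) K_t e^{−½vᵀC⁻¹v} = t⟨w₀, Cw₀⟩ ∫ K_t e^{−½vᵀC⁻¹v} − ∫ e^{−t⟨v,w₀⟩}(∂_{Cw₀}H) e^{−½vᵀC⁻¹v}`,
i.e. `⟨−⟨A, C*Δ^{(k)}CA_k⟩⟩_t = t⟨A_k, C*Δ^{(k)}C C^{(k)}(Λ_{k+1}) C*Δ^{(k)}CA_k⟩ − ⟨⟨A_k, C*Δ^{(k)}C C^{(k)}(Λ_{k+1})(δ/δA) log H⟩⟩_t`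
after division by `Z_t`. [cite: Balaban1988Convergent, (3.28)–(3.29) p.272] -/
theorem eq328_linear_term (C : Matrix ι ι ℝ) (hC : C.PosDef) {H : (ι → ℝ) → ℝ} (hH : ContDiff ℝ 1 H) {K₀ K₁ : ℝ}
    (h0 : ∀ v, ‖H v‖ ≤ K₀) (h1 : ∀ v, ‖fderiv ℝ H v‖ ≤ K₁) (w₀ : ι → ℝ) (t : ℝ) :
    ∫ v : ι → ℝ, -(v ⬝ᵥ w₀) * (Real.exp (-(t * (v ⬝ᵥ w₀))) * H v) * Real.exp (-(1/2 : ℝ) * (v ⬝ᵥ C⁻¹ *ᵥ v)) =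
      t * (w₀ ⬝ᵥ C *ᵥ w₀) *
          (∫ v : ι → ℝ, Real.exp (-(t * (v ⬝ᵥ w₀))) * H v * Real.exp (-(1/2 : ℝ) * (v ⬝ᵥ C⁻¹ *ᵥ v))) -
        (∫ v : ι → ℝ, Real.exp (-(t * (v ⬝ᵥ w₀))) * fderiv ℝ H v (C *ᵥ w₀) *
          Real.exp (-(1/2 : ℝ) * (v ⬝ᵥ C⁻¹ *ᵥ v))) := by
  have h := eq328_tilted_ibp C hC hH h0 h1 w₀ w₀ t
  have hsym : (C *ᵥ w₀) ⬝ᵥ w₀ = w₀ ⬝ᵥ C *ᵥ w₀ := dotProduct_comm _ _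
  have hneg : (fun v : ι → ℝ => -(v ⬝ᵥ w₀) * (Real.exp (-(t * (v ⬝ᵥ w₀))) * H v) *
      Real.exp (-(1/2 : ℝ) * (v ⬝ᵥ C⁻¹ *ᵥ v))) = fun v =>
      -((v ⬝ᵥ w₀) * (Real.exp (-(t * (v ⬝ᵥ w₀))) * H v) * Real.exp (-(1/2 : ℝ) * (v ⬝ᵥ C⁻¹ *ᵥ v))) := by
    funext v
    ring
  rw [hneg, integral_neg, h, hsym]
  ring

/-- The cancellation in (3.28): `∫₀¹ t·c dt = ½c` — with `c = ⟨A_k, C*Δ^{(k)}C C^{(k)}(Λ_{k+1}) C*Δ^{(k)}CA_k⟩` this is the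
term that removes `−½⟨A_k, C*Δ^{(k)}CC^{(k)}(Λ_{k+1})C*Δ^{(k)}CA_k⟩` from the last member of (3.28).
[cite: Balaban1988Convergent, (3.28) p.272] -/
theorem eq328_half (c : ℝ) : ∫ t in (0 : ℝ)..1, t * c = (1/2 : ℝ) * c := by
  rw [intervalIntegral.integral_mul_const, integral_id]
  ring

end Literature.MathematicalPhysics.QuantumFieldTheory.Balaban1983to89.B14.Eq328GaussianIBP
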